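import Summits.QuantumFields.BalabanUV.Beta.GAN24.PeriodicKKTExchangePairing

/-!
# `BalabanUV.Beta.GAN24.DeepProfileContourSum` — binder row G-an2-4 ∕ (CONV-C), W-slot (α-0), ROW (C) AT LEVELS `j ≥ 1`, the (γ) hand's memo
# `HOME/b2b-balaban-gan24-formalise-leaf-06/g54/C-LEVELS-GE1-g54.md` §29 («THE DEPTH TOWER», letter K3): **THE `Lc`-BLOCK CONTOUR SUM OF THE PERIOD-`Lc·N` STAIRCASE
# PRE-IMAGE IS `Lc^{d+1}` TIMES THE PERIOD-`N` PRE-IMAGE ON THE COARSE LATTICE: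
# `contourSum Lc q^{(Lc·N)}_{νβ} κ y = Lc^{d+1}·q^{(N)}_{νβ}(κ, y)`, `q^{(M)}_{νβ}(b′,s) = [b′=ν]·M⁻²·σ̃^{M}_β(s) − [b′=β]·M⁻¹·σ̃^{M}_ν(s)·χ^{M}_β(s)`,
# `σ̃^{M}_κ(s) = s_κ % M − (M−1)∕2`, `χ^{M}_β(s) = [s_β % M = M−1]`** (`ν ≠ β`; every `d`, `Lc, N ≥ 1`). At `N = 1` (`q^{(1)} ≡ 0`) this is gen 53's contour-freeness
# `StaircaseCurrentPeriodic.contourSum_qProfile_eq_zero` of the period-`Lc` pre-image; at `N = Lc` it is the LEVEL BRIDGE of the depth tower: the tent term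
# `𝒬ᵀ𝒬ᵀE2_{k+1}` of L4 (`StepCovarianceSandwich.sandwich_inl_inl`) on the depth-2 pre-images reads the EXCHANGE pattern table `⟨q^{(Lc)}, E2_{k+1} q^{(Lc)}⟩` one level up
# (G-an2-4 CRUX TEAM (2), seat `b2b-balaban-gan24-formalise-leaf-06` = the (γ) hand, gen 54; journal INTENT I-leaf06-g54-6)

NOT IN PRINT; OUR BOOKKEEPING ([folklore] finite arithmetic on `ℤ`; leaf-04's `PeriodicKKTExchangePairing.sum_box_mul_coord` BY NAME; 0 `def`, 0 cited fact, 0 `def … : Prop`, 0 sorry).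
HONEST FRAMING (cell contract, verbatim): «discharging `BetaPertH` makes Bałaban's UV stability UNCONDITIONAL — a real constructive-QFT result; it is NOT the continuum
limit and NOT the Clay problem.»  HONEST DEPENDENCY (verbatim): «continuum YM on T⁴ ⇐ BetaPertH ∧ nine spine estimates (0/9 proved); BetaPertH ⇐ (D1) ∧ (D4) ∧ CAP+tail;
G-an2-4 gates asym, D1 and NE2/3/4.»
* §1 `emod_mul_add` (`(Lc·q + t) % (Lc·N) = Lc·(q % N) + t` for `0 ≤ t < Lc`), `sum_range_deepSaw` (`Σ_{t<Lc} σ̃^{Lc·N}(Lc·q + t) = Lc²·σ̃^{N}(q)`),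
  `deepFace_iff` (`(Lc·q + t + s) % (Lc·N) = Lc·N − 1 ↔ t + s = Lc − 1 ∧ q % N = N − 1` for `t, s < Lc`), `sum_range_range_deepFace` (`Σ_{t,s<Lc} χ^{Lc·N}(Lc·q + t + s) = Lc·χ^{N}(q)`).
* §2 **`contourSum_deepProfile`** (the title).
Asserts NO value of Bałaban's tables; discharges NOTHING of (C) ∕ (C)sym ∕ (Q-L) ∕ «T2Shape» ∕ «T2Drift» ∕ (hW, hWall); NEVER «G-an2-4 closed» as (CONV-C); NOT D1, NOT `BetaPertH`,
NOT continuum, NOT Clay.  2026-08-24; no existing file touched.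
-/

noncomputable section

open Finset
open scoped BigOperators
open Literature.MathematicalPhysics.QuantumFieldTheory
open Literature.MathematicalPhysics.QuantumFieldTheory.Balaban1983to89
open Literature.MathematicalPhysics.QuantumFieldTheory.Balaban1983to89.Beta
open ExpKernelCalculus (Site)
open AffineAveraging (box toSite unitVec contourSum)
open Summit.QuantumFields.BalabanUV.Beta.GAN24.PeriodicKKTExchangePairing (sum_box_mul_coord)

namespace Summit.QuantumFields.BalabanUV.Beta.GAN24.DeepProfileContourSum

variable {d : ℕ}

/-! ## §1 Nested remainders, the deep sawtooth over one block, the deep face count -/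

/-- [folklore] **NESTED REMAINDER**: `(Lc·q + t) % (Lc·N) = Lc·(q % N) + t` for `0 < Lc`, `0 < N`, `0 ≤ t < Lc`. -/
theorem emod_mul_add {Lc N : ℤ} (hLc : 0 < Lc) (hN : 0 < N) (q : ℤ) {t : ℤ} (ht0 : 0 ≤ t) (htL : t < Lc) :
    (Lc * q + t) % (Lc * N) = Lc * (q % N) + t := by
  have hr0 : 0 ≤ q % N := Int.emod_nonneg _ hN.ne'
  have hrN : q % N < N := Int.emod_lt_of_pos _ hN
  have hq : q = N * (q / N) + q % N := by have e := Int.emod_def q N; linarith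
  have e : Lc * q + t = (Lc * (q % N) + t) + (Lc * N) * (q / N) := by linear_combination Lc * hq
  rw [e, Int.add_mul_emod_self_left]
  exact Int.emod_eq_of_lt (by nlinarith) (by nlinarith)

/-- [folklore] **THE DEEP SAWTOOTH SUMMED OVER ONE BLOCK**: `Σ_{t<Lc} ((Lc·q + t) % (Lc·N) − (Lc·N − 1)∕2) = Lc²·((q % N) − (N − 1)∕2)` (as reals; `1 ≤ Lc`, `1 ≤ N`). -/
theorem sum_range_deepSaw {Lc N : ℕ} (hLc : 1 ≤ Lc) (hN : 1 ≤ N) (q : ℤ) :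
    ∑ t ∈ Finset.range Lc, (((((Lc : ℤ) * q + (t : ℤ)) % ((Lc : ℤ) * (N : ℤ)) : ℤ) : ℝ) - (((Lc : ℝ) * (N : ℝ)) - 1) / 2) =
      ((Lc : ℝ) * (Lc : ℝ)) * ((((q % (N : ℤ) : ℤ) : ℝ)) - ((N : ℝ) - 1) / 2) := by
  have hLc0 : (0 : ℤ) < Lc := by exact_mod_cast hLc
  have hN0 : (0 : ℤ) < N := by exact_mod_cast hN
  have e : ∀ t ∈ Finset.range Lc, (((((Lc : ℤ) * q + (t : ℤ)) % ((Lc : ℤ) * (N : ℤ)) : ℤ) : ℝ) - (((Lc : ℝ) * (N : ℝ)) - 1) / 2) =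
      (t : ℝ) + ((Lc : ℝ) * (((q % (N : ℤ) : ℤ) : ℝ)) - (((Lc : ℝ) * (N : ℝ)) - 1) / 2) := by
    intro t ht
    have ht' : ((t : ℕ) : ℤ) < (Lc : ℤ) := by exact_mod_cast Finset.mem_range.1 ht
    rw [emod_mul_add hLc0 hN0 q (by positivity) ht']
    push_cast
    ring
  rw [Finset.sum_congr rfl e, Finset.sum_add_distrib, Finset.sum_const, Finset.card_range, nsmul_eq_mul]
  have hG : (∑ i ∈ Finset.range Lc, (i : ℝ)) * 2 = (Lc : ℝ) * ((Lc : ℝ) - 1) := by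
    have h := congrArg (Nat.cast : ℕ → ℝ) (Finset.sum_range_id_mul_two Lc)
    push_cast [Nat.cast_sub hLc] at h
    exact h
  linarith

/-- [folklore] **THE DEEP FACE CONDITION OVER ONE BLOCK**: for `t, s < Lc`, `(Lc·q + t + s) % (Lc·N) = Lc·N − 1 ↔ (t + s = Lc − 1 ∧ q % N = N − 1)`. -/
theorem deepFace_iff {Lc N : ℤ} (hLc : 0 < Lc) (hN : 0 < N) (q : ℤ) {t s : ℤ} (ht0 : 0 ≤ t) (htL : t < Lc) (hs0 : 0 ≤ s) (hsL : s < Lc) :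
    (Lc * q + t + s) % (Lc * N) = Lc * N - 1 ↔ (t + s = Lc - 1 ∧ q % N = N - 1) := by
  have hr0 : 0 ≤ q % N := Int.emod_nonneg _ hN.ne'
  have hrN : q % N < N := Int.emod_lt_of_pos _ hN
  by_cases hlt : t + s < Lc
  · -- one block: `(Lc q + (t+s)) % (Lc N) = Lc (q % N) + (t + s)`
    have e : (Lc * q + t + s) % (Lc * N) = Lc * (q % N) + (t + s) := by
      rw [add_assoc]; exact emod_mul_add hLc hN q (by linarith) hlt
    rw [e]
    constructor
    · intro h
      have h1 : Lc * (N - 1 - q % N) = t + s + 1 - Lc := by linarith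
      have hk0 : 0 ≤ N - 1 - q % N := by linarith
      -- `Lc·k = t+s+1−Lc ∈ (−Lc, 0]·…`: only `k = 0` fits
      have hk : N - 1 - q % N = 0 := by
        by_contra hne
        have hk1 : 1 ≤ N - 1 - q % N := by omega
        have : Lc ≤ Lc * (N - 1 - q % N) := by nlinarith
        linarith
      refine ⟨?_, by linarith⟩
      rw [hk, mul_zero] at h1
      linarith
    · rintro ⟨h1, h2⟩
      rw [h1, h2]; ring
  · -- spill-over into the next block: `t + s = Lc + u′` with `0 ≤ u′ ≤ Lc − 2`; the remainder is `Lc·((q+1) % N) + u′ ≠ Lc·N − 1`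
    push Not at hlt
    have hr0' : 0 ≤ (q + 1) % N := Int.emod_nonneg _ hN.ne'
    have hrN' : (q + 1) % N < N := Int.emod_lt_of_pos _ hN
    have e : (Lc * q + t + s) % (Lc * N) = Lc * ((q + 1) % N) + (t + s - Lc) := by
      have e1 : Lc * q + t + s = Lc * (q + 1) + (t + s - Lc) := by ring
      rw [e1]; exact emod_mul_add hLc hN (q + 1) (by linarith) (by linarith)
    rw [e]
    constructor
    · intro h
      exfalso
      have h1 : Lc * (N - (q + 1) % N) = t + s - Lc + 1 := by linarith
      have hk1 : 1 ≤ N - (q + 1) % N := by linarith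
      have : Lc ≤ Lc * (N - (q + 1) % N) := by nlinarith
      linarith
    · rintro ⟨h1, -⟩
      exfalso; linarith

/-- [folklore] **THE DEEP FACE COUNT OVER ONE BLOCK**: `Σ_{t<Lc} Σ_{s<Lc} [(Lc·q + t + s) % (Lc·N) = Lc·N − 1] = Lc·[q % N = N − 1]` (`1 ≤ Lc`, `1 ≤ N`). -/
theorem sum_range_range_deepFace {Lc N : ℕ} (hLc : 1 ≤ Lc) (hN : 1 ≤ N) (q : ℤ) :
    ∑ t ∈ Finset.range Lc, ∑ s ∈ Finset.range Lc,
        (if ((Lc : ℤ) * q + (t : ℤ) + (s : ℤ)) % ((Lc : ℤ) * (N : ℤ)) = (Lc : ℤ) * (N : ℤ) - 1 then (1 : ℝ) else 0) =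
      (Lc : ℝ) * (if q % (N : ℤ) = (N : ℤ) - 1 then (1 : ℝ) else 0) := by
  classical
  have hLc0 : (0 : ℤ) < Lc := by exact_mod_cast hLc
  have hN0 : (0 : ℤ) < N := by exact_mod_cast hN
  -- rewrite the indicator with `deepFace_iff`
  have e : ∀ t ∈ Finset.range Lc, ∀ s ∈ Finset.range Lc,
      (if ((Lc : ℤ) * q + (t : ℤ) + (s : ℤ)) % ((Lc : ℤ) * (N : ℤ)) = (Lc : ℤ) * (N : ℤ) - 1 then (1 : ℝ) else 0) =
        (if q % (N : ℤ) = (N : ℤ) - 1 then (1 : ℝ) else 0) * (if s = Lc - 1 - t then (1 : ℝ) else 0) := by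
    intro t ht s hs
    have ht' := Finset.mem_range.1 ht
    have hs' := Finset.mem_range.1 hs
    have key := deepFace_iff hLc0 hN0 q (t := (t : ℤ)) (s := (s : ℤ)) (by positivity) (by exact_mod_cast ht') (by positivity) (by exact_mod_cast hs')
    have hts : ((t : ℤ) + (s : ℤ) = (Lc : ℤ) - 1) ↔ s = Lc - 1 - t := by omega
    by_cases h1 : q % (N : ℤ) = (N : ℤ) - 1
    · by_cases h2 : s = Lc - 1 - t
      · rw [if_pos (key.2 ⟨hts.2 h2, h1⟩), if_pos h1, if_pos h2, one_mul]
      · rw [if_neg (fun h => h2 (hts.1 (key.1 h).1)), if_pos h1, if_neg h2, mul_zero]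
    · rw [if_neg (fun h => h1 (key.1 h).2), if_neg h1, zero_mul]
  rw [Finset.sum_congr rfl fun t ht => Finset.sum_congr rfl fun s hs => e t ht s hs]
  have hin : ∀ t ∈ Finset.range Lc, (∑ s ∈ Finset.range Lc, (if q % (N : ℤ) = (N : ℤ) - 1 then (1 : ℝ) else 0) * (if s = Lc - 1 - t then (1 : ℝ) else 0)) =
      (if q % (N : ℤ) = (N : ℤ) - 1 then (1 : ℝ) else 0) := by
    intro t ht
    have ht' := Finset.mem_range.1 ht
    rw [← Finset.mul_sum, Finset.sum_ite_eq' (Finset.range Lc) (Lc - 1 - t) (fun _ => (1 : ℝ)), if_pos (Finset.mem_range.2 (by omega)), mul_one]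
  rw [Finset.sum_congr rfl hin, Finset.sum_const, Finset.card_range, nsmul_eq_mul]

/-! ## §2 The block contour sum of the deep pre-image -/

variable {Lc : ℕ} [NeZero Lc]

omit [NeZero Lc] in
/-- [folklore] Coordinates of the contour point `Lc•y + b + s•e_κ`: off the contour direction (`i ≠ κ`) it is `Lc·y_i + b_i`; along it, `Lc·y_κ + b_κ + s`. -/
theorem contourPt_apply_of_ne (y : Site (d + 1)) (b : Fin (d + 1) → ℕ) (s : ℕ) {κ i : Fin (d + 1)} (h : i ≠ κ) :
    ((Lc : ℤ) • y + toSite b + (s : ℤ) • unitVec κ) i = (Lc : ℤ) * y i + (toSite b i) := by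
  simp only [Pi.add_apply, Pi.smul_apply, smul_eq_mul, AffineAveraging.unitVec, Pi.single_apply, if_neg h, mul_zero, add_zero]

omit [NeZero Lc] in
/-- [folklore] The same along the contour direction. -/
theorem contourPt_apply_self (y : Site (d + 1)) (b : Fin (d + 1) → ℕ) (s : ℕ) (κ : Fin (d + 1)) :
    ((Lc : ℤ) • y + toSite b + (s : ℤ) • unitVec κ) κ = (Lc : ℤ) * y κ + (toSite b κ) + (s : ℤ) := by
  simp only [Pi.add_apply, Pi.smul_apply, smul_eq_mul, AffineAveraging.unitVec, Pi.single_eq_same, mul_one]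

/-- [folklore] **THE `Lc`-BLOCK CONTOUR SUM OF THE PERIOD-`Lc·N` PRE-IMAGE IS `Lc^{d+1}` TIMES THE PERIOD-`N` PRE-IMAGE** (`ν ≠ β`, `1 ≤ N`; every `κ`, `y`):
`contourSum Lc q^{(Lc·N)}_{νβ} κ y = Lc^{d+1}·q^{(N)}_{νβ}(κ, y)`.  (`κ = ν`: the deep sawtooth over one block, `sum_range_deepSaw`; `κ = β`: the deep sawtooth in direction
`ν` times the deep face count in direction `β`, `sum_range_range_deepFace`; both through `sum_box_mul_coord`; other `κ`: `0 = 0`.) -/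
theorem contourSum_deepProfile {N : ℕ} (hN : 1 ≤ N) {ν β : Fin (d + 1)} (hνβ : ν ≠ β) (κ : Fin (d + 1)) (y : Site (d + 1)) :
    contourSum Lc (fun b' (s : Site (d + 1)) =>
        (if b' = ν then (((Lc : ℝ) * (N : ℝ))⁻¹ * ((Lc : ℝ) * (N : ℝ))⁻¹) *
            ((((s β % ((Lc : ℤ) * (N : ℤ)) : ℤ) : ℝ) - (((Lc : ℝ) * (N : ℝ)) - 1) / 2)) else 0)
          + (if b' = β then (-((Lc : ℝ) * (N : ℝ))⁻¹ * ((((s ν % ((Lc : ℤ) * (N : ℤ)) : ℤ) : ℝ) - (((Lc : ℝ) * (N : ℝ)) - 1) / 2))) *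
            (if s β % ((Lc : ℤ) * (N : ℤ)) = (Lc : ℤ) * (N : ℤ) - 1 then (1 : ℝ) else 0) else 0)) κ y =
      (Lc : ℝ) ^ (d + 1) *
        ((if κ = ν then (((N : ℝ))⁻¹ * ((N : ℝ))⁻¹) * ((((y β % (N : ℤ)) : ℤ) : ℝ) - ((N : ℝ) - 1) / 2) else 0)
          + (if κ = β then (-((N : ℝ))⁻¹ * ((((y ν % (N : ℤ)) : ℤ) : ℝ) - ((N : ℝ) - 1) / 2)) *
            (if y β % (N : ℤ) = (N : ℤ) - 1 then (1 : ℝ) else 0) else 0)) := by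
  classical
  have hLc : 1 ≤ Lc := Nat.one_le_iff_ne_zero.2 (NeZero.ne Lc)
  have hLcR : (Lc : ℝ) ≠ 0 := by exact_mod_cast (NeZero.ne Lc)
  have hNR : (N : ℝ) ≠ 0 := by exact_mod_cast (Nat.one_le_iff_ne_zero.1 hN)
  -- `ν ≠ β` forces `d ≥ 1`; the scalar bookkeeping `Lc^{d+1} = Lc^{d−1}·Lc²`
  have hd : 1 ≤ d := by
    rcases Nat.eq_zero_or_pos d with h0 | h
    · subst h0
      exact absurd (Fin.ext (by have h1 := ν.isLt; have h2 := β.isLt; omega)) hνβ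
    · exact h
  have ep : (Lc : ℝ) ^ (d + 1) = (Lc : ℝ) ^ (d - 1) * ((Lc : ℝ) * (Lc : ℝ)) := by
    rw [show d + 1 = (d - 1) + 2 by omega, pow_add]; ring
  unfold AffineAveraging.contourSum
  by_cases hκν : κ = ν
  · subst hκν
    simp only [if_true, if_neg hνβ, add_zero]
    simp_rw [contourPt_apply_of_ne (Lc := Lc) y _ _ (Ne.symm hνβ)]
    -- the summand does not depend on `s` nor on `b_κ`
    simp only [Finset.sum_const, Finset.card_range, nsmul_eq_mul]
    have h := sum_box_mul_coord (d := d) (N := Lc) (Ne.symm hνβ)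
      (fun t : ℤ => (Lc : ℝ) * ((((Lc : ℝ) * (N : ℝ))⁻¹ * ((Lc : ℝ) * (N : ℝ))⁻¹) *
        (((((((Lc : ℤ) * y β + t) % ((Lc : ℤ) * (N : ℤ))) : ℤ) : ℝ)) - (((Lc : ℝ) * (N : ℝ)) - 1) / 2)))
      (fun _ : ℤ => (1 : ℝ))
    simp only [mul_one, Finset.sum_const, Finset.card_range, nsmul_eq_mul] at h
    rw [h, ← Finset.mul_sum, ← Finset.mul_sum, sum_range_deepSaw hLc hN (y β), ep]
    -- scalars: `Lc^{d-1}·(Lc·(c·Lc²·σ̃))·Lc = Lc^{d+1}·N⁻²σ̃`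
    field_simp
    try ring
  · by_cases hκβ : κ = β
    · subst hκβ
      simp only [if_true, if_neg hκν, zero_add]
      simp_rw [contourPt_apply_of_ne (Lc := Lc) y _ _ hνβ, contourPt_apply_self (Lc := Lc) y]
      have e2 : ∀ b : Fin (d + 1) → ℕ, (∑ s ∈ Finset.range Lc,
          (-((Lc : ℝ) * (N : ℝ))⁻¹ * (((((((Lc : ℤ) * y ν + toSite b ν) % ((Lc : ℤ) * (N : ℤ))) : ℤ) : ℝ)) - (((Lc : ℝ) * (N : ℝ)) - 1) / 2)) *
            (if ((Lc : ℤ) * y κ + toSite b κ + (s : ℤ)) % ((Lc : ℤ) * (N : ℤ)) = (Lc : ℤ) * (N : ℤ) - 1 then (1 : ℝ) else 0)) =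
          (fun t : ℤ => -((Lc : ℝ) * (N : ℝ))⁻¹ * (((((((Lc : ℤ) * y ν + t) % ((Lc : ℤ) * (N : ℤ))) : ℤ) : ℝ)) - (((Lc : ℝ) * (N : ℝ)) - 1) / 2)) (toSite b ν) *
            (fun t : ℤ => ∑ s ∈ Finset.range Lc,
              (if ((Lc : ℤ) * y κ + t + (s : ℤ)) % ((Lc : ℤ) * (N : ℤ)) = (Lc : ℤ) * (N : ℤ) - 1 then (1 : ℝ) else 0)) (toSite b κ) := by
        intro b
        rw [Finset.mul_sum]
      rw [Finset.sum_congr rfl fun b _ => e2 b,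
        sum_box_mul_coord (d := d) (N := Lc) hνβ
          (fun t : ℤ => -((Lc : ℝ) * (N : ℝ))⁻¹ * (((((((Lc : ℤ) * y ν + t) % ((Lc : ℤ) * (N : ℤ))) : ℤ) : ℝ)) - (((Lc : ℝ) * (N : ℝ)) - 1) / 2))
          (fun t : ℤ => ∑ s ∈ Finset.range Lc,
            (if ((Lc : ℤ) * y κ + t + (s : ℤ)) % ((Lc : ℤ) * (N : ℤ)) = (Lc : ℤ) * (N : ℤ) - 1 then (1 : ℝ) else 0))]
      have hf : (∑ t ∈ Finset.range Lc, (fun t : ℤ => -((Lc : ℝ) * (N : ℝ))⁻¹ *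
          (((((((Lc : ℤ) * y ν + t) % ((Lc : ℤ) * (N : ℤ))) : ℤ) : ℝ)) - (((Lc : ℝ) * (N : ℝ)) - 1) / 2)) (t : ℤ)) =
          -((Lc : ℝ) * (N : ℝ))⁻¹ * (((Lc : ℝ) * (Lc : ℝ)) * ((((y ν % (N : ℤ) : ℤ) : ℝ)) - ((N : ℝ) - 1) / 2)) := by
        rw [← sum_range_deepSaw hLc hN (y ν), Finset.mul_sum]
      have hg : (∑ t ∈ Finset.range Lc, (fun t : ℤ => ∑ s ∈ Finset.range Lc,
          (if ((Lc : ℤ) * y κ + t + (s : ℤ)) % ((Lc : ℤ) * (N : ℤ)) = (Lc : ℤ) * (N : ℤ) - 1 then (1 : ℝ) else 0)) (t : ℤ)) =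
          (Lc : ℝ) * (if y κ % (N : ℤ) = (N : ℤ) - 1 then (1 : ℝ) else 0) := sum_range_range_deepFace hLc hN (y κ)
      rw [hf, hg, ep]
      field_simp
      try ring
    · -- `κ ∉ {ν, β}`: both sides vanish
      simp only [if_neg hκν, if_neg hκβ, add_zero, Finset.sum_const_zero, mul_zero]

end Summit.QuantumFields.BalabanUV.Beta.GAN24.DeepProfileContourSum

end
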